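import Summits.NavierStokesRegularity.OSWSelfSimilar.SheetRGeneratorOddWeak
import Literature.Analysis.OperatorTheory.PseudoResolventRankOneEigenvalue
import HarnessLib

/-!
# SHEET-ℝ frame, (P2)/(P3) of Z3-SR-SPEC on the odd class: the EVANS FUNCTION `E(σ) = 1 − θℓ(R_K(σ)f)` of a rank-one perturbation of
# `A = (−∂² + d∂ + V) + K`, and «WEAK eigenvalue of `A − θℓ(·)f` ⇔ zero of `E`», «simple zero ⇒ simple weak eigenvalue» — instantiated by name

HONEST FRAMING (cell ns-blowup GROUP B / zone Z3, case Z3-SR-SPEC, PAPER items (P2) «Sherman–Morrison: `DG(Ω̄) + σJ = 𝒜(σ) − F` has a kernel iff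
`E(σ) = 0`» and (P3) «order of the zero = algebraic multiplicity» (rank-one case); 1-D MODEL certificate frame (viscous gCLM/OSW sheet on the line);
not Euler/NS; «violates: none — MODEL»). Nothing here asserts that a profile exists or that any zero exists; the Gårding datum ((S1), interval
arithmetic) is the HYPOTHESIS `GardingDataKC`; `K : Esp L hL →L[ℝ] W L`, the vector `f ∈ Wcodd L`, the functional `ℓ : Wcodd L →L[ℂ] ℂ` and `θ ∈ ℂ` are
ARBITRARY (cert-1: `K = −P + F`, `F = θ(v₀, ·)_E v₀`, so `A_F − θℓ(·)f = DG(Ω̄)` once `ℓ` is the `L²_w`-bounded form of `(v₀, ·)_E` and `f = v₀`).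

The abstract sentences are cert-4's `Literature…PseudoResolventRankOneEigenvalue` (`kernel_rankOne_iff_evans`, `eigen_rankOne_iff`,
`algebraicallySimple_of_analyticOrderAt_eq_one`); the resolvent is selfsim's `resolventOdd` (injective pseudo-resolvent on the odd class,
`SheetRResolventOddClass`) and the translation between Kato's closed operator `T = generatorOdd` and the WEAK differential operator is
`SheetRGeneratorOddWeak` (`T = −A`).  Results, for `Re σ > −m`:

* `evansOdd hL K h ℓ f θ σ := 1 − θ·ℓ(resolventOdd σ f)`; `analyticOnNhd_evansOdd` (analytic on the half-plane), `deriv_evansOdd`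
  (`E′(σ) = θℓ(R(σ)R(σ)f)`);
* `IsWeakEigen … σ u` := «`u ∈ L²_{w,odd}(ℂ)` has energy-space coordinates and `A u = θℓ(u)f − σu` weakly» (i.e. `(A − θℓ(·)f + σ)u = 0`);
  `isWeakEigen_iff_generator` (⇔ `u ∈ D(T)`, `Tu = σu − θℓ(u)f`); likewise `IsWeakJordan` / `isWeakJordan_iff_generator` for generalized eigenvectors;
* **`exists_weakEigen_iff_evansOdd_eq_zero`** — (P2): a non-trivial weak eigenvector at `σ` exists iff `E(σ) = 0`;
* **`weakEigen_simple_of_analyticOrderAt_eq_one`** — (P3), rank-one case: if `E` vanishes at `σ` to order exactly one, then the weak eigenspace at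
  `σ` is the line spanned by `R_K(σ)f ≠ 0` and NO weak generalized eigenvector exists (geometrically and algebraically simple).
Two definitions (`evansOdd`; `IsWeakEigen`/`IsWeakJordan` are `Prop`s); no named fact.  WHAT THIS IS NOT: not NS; not the certificate (no zero of
`E` is asserted); no number of record moves.
-/

noncomputable section

namespace Summit.NavierStokesRegularity.OSWSelfSimilar
namespace SheetREvansOdd

open _root_.MeasureTheory _root_.Set _root_.Filter _root_.Real SheetRWeakProfilePV SheetRWeakToStrong SheetREnergyClass SheetRWeightedMeasure
  SheetRLinearisedTests SheetREnergySpace SheetRTestSpace SheetRLinearisedFormBounds SheetRSolutionOperator SheetRLinearisedCutoffEnergy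
  SheetRResolventPair SheetRComplexPivot SheetRResolventComplex SheetRResolventIdentity SheetRPerturbedUniqueness SheetRPerturbedPair
  SheetRPerturbedResolventC SheetRPerturbedResolventIdentityC SheetROddClass SheetRResolventOddClass SheetRGeneratorOddWeak
  Literature.Analysis.OperatorTheory
open scoped Topology ENNReal

variable {L D₀ D₁ V₀ c m : ℝ} {d V : ℝ → ℝ}

/-! ### §1 The Evans function on the odd class -/

/-- **The Evans function** of the rank-one perturbation `u ↦ θℓ(u)f` of `A` on the odd class: `E(σ) = 1 − θ·ℓ(R_K(σ)f)`. [folklore] -/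
def evansOdd (hL : 0 < L) (K : Esp L hL →L[ℝ] W L) (h : GardingDataKC L hL d V K D₀ D₁ V₀ c m) (ℓ : Wcodd L →L[ℂ] ℂ) (f : Wcodd L)
    (θ : ℂ) (σ : ℂ) : ℂ :=
  1 - θ * ℓ (resolventOdd hL K h σ f)

/-- Unfolding `evansOdd` as a function of `σ`. [folklore] -/
theorem evansOdd_eq (hL : 0 < L) (K : Esp L hL →L[ℝ] W L) (h : GardingDataKC L hL d V K D₀ D₁ V₀ c m) (ℓ : Wcodd L →L[ℂ] ℂ)
    (f : Wcodd L) (θ : ℂ) : evansOdd hL K h ℓ f θ = fun σ => 1 - θ * ℓ (resolventOdd hL K h σ f) := rfl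

/-- **`E` is analytic on the half-plane `Re σ > −m`.** [folklore] -/
theorem analyticOnNhd_evansOdd (hL : 0 < L) (K : Esp L hL →L[ℝ] W L) (h : GardingDataKC L hL d V K D₀ D₁ V₀ c m) (ℓ : Wcodd L →L[ℂ] ℂ)
    (f : Wcodd L) (θ : ℂ) : AnalyticOnNhd ℂ (evansOdd hL K h ℓ f θ) {σ : ℂ | -m < σ.re} := by
  haveI : CompleteSpace (Wcodd L) := completeSpace_Wcodd L
  rw [evansOdd_eq]
  exact (isPseudoResolvent_resolventOdd hL K h).analyticOnNhd_evans (isOpen_halfPlane m) ℓ f θ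

/-- **`E′(σ) = θ·ℓ(R_K(σ)R_K(σ)f)`.** [folklore] -/
theorem deriv_evansOdd (hL : 0 < L) (K : Esp L hL →L[ℝ] W L) (h : GardingDataKC L hL d V K D₀ D₁ V₀ c m) (ℓ : Wcodd L →L[ℂ] ℂ)
    (f : Wcodd L) (θ : ℂ) {σ : ℂ} (hσ : -m < σ.re) :
    deriv (evansOdd hL K h ℓ f θ) σ = θ * ℓ (resolventOdd hL K h σ (resolventOdd hL K h σ f)) := by
  haveI : CompleteSpace (Wcodd L) := completeSpace_Wcodd L
  rw [evansOdd_eq]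
  exact (isPseudoResolvent_resolventOdd hL K h).deriv_evans (isOpen_halfPlane m) hσ ℓ f θ

/-! ### §2 Weak eigenvectors and weak Jordan chains of `A − θℓ(·)f` -/

/-- **Weak eigenvector**: `u ∈ L²_{w,odd}(ℂ)` has energy-space coordinates `P` and `A(u_R + iu_I) = θℓ(u)f − σu` weakly, i.e.
`(A − θℓ(·)f + σ)u = 0` in the weak sense of `SheetRGeneratorOddWeak.IsWeakImage`. [folklore] -/
def IsWeakEigen (hL : 0 < L) (K : Esp L hL →L[ℝ] W L) (d V : ℝ → ℝ) (ℓ : Wcodd L →L[ℂ] ℂ) (f : Wcodd L) (θ σ : ℂ) (u : Wcodd L) : Prop :=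
  ∃ P : WithLp 2 (Esp L hL × Esp L hL), toPair L (u : Wc L) = ιpair hL P ∧
    IsWeakImage hL K d V P ((θ * ℓ u) • (f : Wc L) - σ • (u : Wc L))

/-- **Weak generalized eigenvector** over `δ₀`: `(A − θℓ(·)f + σ)δ₁ = −δ₀` weakly, i.e. `A δ₁ = θℓ(δ₁)f − σδ₁ − δ₀`. [folklore] -/
def IsWeakJordan (hL : 0 < L) (K : Esp L hL →L[ℝ] W L) (d V : ℝ → ℝ) (ℓ : Wcodd L →L[ℂ] ℂ) (f : Wcodd L) (θ σ : ℂ) (δ₀ δ₁ : Wcodd L) :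
    Prop :=
  ∃ P : WithLp 2 (Esp L hL × Esp L hL), toPair L (δ₁ : Wc L) = ιpair hL P ∧
    IsWeakImage hL K d V P ((θ * ℓ δ₁) • (f : Wc L) - σ • (δ₁ : Wc L) - (δ₀ : Wc L))

/-- Weak eigenvector ⇔ Kato's closed operator `T = generatorOdd` has `u ∈ D(T)`, `Tu = σu − θℓ(u)f`. [folklore] -/
theorem isWeakEigen_iff_generator (hL : 0 < L) (K : Esp L hL →L[ℝ] W L) (h : GardingDataKC L hL d V K D₀ D₁ V₀ c m) {σ₀ : ℂ}
    (hσ₀ : -m < σ₀.re) (ℓ : Wcodd L →L[ℂ] ℂ) (f : Wcodd L) (θ σ : ℂ) (u : Wcodd L) :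
    IsWeakEigen hL K d V ℓ f θ σ u ↔
      ∃ hu : u ∈ (generatorOdd hL K h σ₀ hσ₀).domain, generatorOdd hL K h σ₀ hσ₀ ⟨u, hu⟩ = σ • u - (θ * ℓ u) • f := by
  constructor
  · rintro ⟨P, hP, hw⟩
    have hw' : IsWeakImage hL K d V P ((((θ * ℓ u) • f - σ • u : Wcodd L)) : Wc L) := by
      rwa [Submodule.coe_sub, Submodule.coe_smul, Submodule.coe_smul]
    obtain ⟨hu, hT⟩ := mem_domain_of_weak hL K h hσ₀ hP hw'
    exact ⟨hu, by rw [hT, neg_sub]⟩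
  · rintro ⟨hu, hT⟩
    obtain ⟨P, hP, hw⟩ := weak_of_mem_domain hL K h hσ₀ hu
    refine ⟨P, hP, ?_⟩
    have e : -((generatorOdd hL K h σ₀ hσ₀ ⟨u, hu⟩ : Wcodd L) : Wc L) = (θ * ℓ u) • (f : Wc L) - σ • (u : Wc L) := by
      rw [hT, Submodule.coe_sub, Submodule.coe_smul, Submodule.coe_smul, neg_sub]
    rwa [e] at hw

/-- Weak generalized eigenvector ⇔ `δ₁ ∈ D(T)`, `Tδ₁ = σδ₁ − θℓ(δ₁)f + δ₀`. [folklore] -/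
theorem isWeakJordan_iff_generator (hL : 0 < L) (K : Esp L hL →L[ℝ] W L) (h : GardingDataKC L hL d V K D₀ D₁ V₀ c m) {σ₀ : ℂ}
    (hσ₀ : -m < σ₀.re) (ℓ : Wcodd L →L[ℂ] ℂ) (f : Wcodd L) (θ σ : ℂ) (δ₀ δ₁ : Wcodd L) :
    IsWeakJordan hL K d V ℓ f θ σ δ₀ δ₁ ↔
      ∃ hu : δ₁ ∈ (generatorOdd hL K h σ₀ hσ₀).domain, generatorOdd hL K h σ₀ hσ₀ ⟨δ₁, hu⟩ = σ • δ₁ - (θ * ℓ δ₁) • f + δ₀ := by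
  constructor
  · rintro ⟨P, hP, hw⟩
    have hw' : IsWeakImage hL K d V P ((((θ * ℓ δ₁) • f - σ • δ₁ - δ₀ : Wcodd L)) : Wc L) := by
      rwa [Submodule.coe_sub, Submodule.coe_sub, Submodule.coe_smul, Submodule.coe_smul]
    obtain ⟨hu, hT⟩ := mem_domain_of_weak hL K h hσ₀ hP hw'
    refine ⟨hu, ?_⟩
    rw [hT]
    abel
  · rintro ⟨hu, hT⟩
    obtain ⟨P, hP, hw⟩ := weak_of_mem_domain hL K h hσ₀ hu
    refine ⟨P, hP, ?_⟩
    have e : -((generatorOdd hL K h σ₀ hσ₀ ⟨δ₁, hu⟩ : Wcodd L) : Wc L) = (θ * ℓ δ₁) • (f : Wc L) - σ • (δ₁ : Wc L) - (δ₀ : Wc L) := by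
      rw [hT, Submodule.coe_add, Submodule.coe_sub, Submodule.coe_smul, Submodule.coe_smul]
      abel
    rwa [e] at hw

/-! ### §3 (P2): weak eigenvalue ⇔ zero of the Evans function -/

/-- **(P2) on the odd class.**  For `Re σ > −m`: `A − θℓ(·)f` has a non-trivial WEAK eigenvector with eigenvalue `−σ` (i.e. a non-zero weak
solution of `(A − θℓ(·)f + σ)u = 0` in `L²_{w,odd}(ℂ)` with energy-space coordinates) iff `E(σ) = 1 − θℓ(R_K(σ)f) = 0`. [folklore] -/
theorem exists_weakEigen_iff_evansOdd_eq_zero (hL : 0 < L) (K : Esp L hL →L[ℝ] W L) (h : GardingDataKC L hL d V K D₀ D₁ V₀ c m)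
    (ℓ : Wcodd L →L[ℂ] ℂ) (f : Wcodd L) (θ : ℂ) {σ : ℂ} (hσ : -m < σ.re) :
    (∃ u : Wcodd L, u ≠ 0 ∧ IsWeakEigen hL K d V ℓ f θ σ u) ↔ evansOdd hL K h ℓ f θ σ = 0 := by
  have hps := isPseudoResolvent_resolventOdd hL K h
  rw [evansOdd, ← IsPseudoResolvent.kernel_rankOne_iff_evans (resolventOdd hL K h σ) ℓ f θ]
  constructor
  · rintro ⟨u, hu0, hw⟩
    exact ⟨u, hu0, (hps.eigen_rankOne_iff (hinj := injective_resolventOdd hL K h hσ) hσ hσ ℓ f θ u).1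
      ((isWeakEigen_iff_generator hL K h hσ ℓ f θ σ u).1 hw)⟩
  · rintro ⟨u, hu0, hu⟩
    exact ⟨u, hu0, (isWeakEigen_iff_generator hL K h hσ ℓ f θ σ u).2
      ((hps.eigen_rankOne_iff (hinj := injective_resolventOdd hL K h hσ) hσ hσ ℓ f θ u).2 hu)⟩

/-! ### §4 (P3), rank-one case: a simple zero of `E` is a simple weak eigenvalue -/

/-- **Simple zero ⇒ simple weak eigenvalue.**  If `E` vanishes at `σ` (`Re σ > −m`) to order exactly one, then `R_K(σ)f ≠ 0`, the weak
eigenvectors at `σ` are exactly the multiples of `R_K(σ)f`, and no weak generalized eigenvector over a non-zero eigenvector exists. [folklore] -/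
theorem weakEigen_simple_of_analyticOrderAt_eq_one (hL : 0 < L) (K : Esp L hL →L[ℝ] W L) (h : GardingDataKC L hL d V K D₀ D₁ V₀ c m)
    (ℓ : Wcodd L →L[ℂ] ℂ) (f : Wcodd L) (θ : ℂ) {σ : ℂ} (hσ : -m < σ.re) (hE1 : analyticOrderAt (evansOdd hL K h ℓ f θ) σ = 1) :
    resolventOdd hL K h σ f ≠ 0 ∧
      (∀ u : Wcodd L, IsWeakEigen hL K d V ℓ f θ σ u ↔ ∃ t : ℂ, u = t • resolventOdd hL K h σ f) ∧
      ∀ δ₀ : Wcodd L, δ₀ ≠ 0 → IsWeakEigen hL K d V ℓ f θ σ δ₀ → ¬ ∃ δ₁ : Wcodd L, IsWeakJordan hL K d V ℓ f θ σ δ₀ δ₁ := by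
  haveI : CompleteSpace (Wcodd L) := completeSpace_Wcodd L
  have hps := isPseudoResolvent_resolventOdd hL K h
  rw [evansOdd_eq] at hE1
  obtain ⟨hf0, hgeo, halg⟩ := hps.algebraicallySimple_of_analyticOrderAt_eq_one (hinj := injective_resolventOdd hL K h hσ)
    (isOpen_halfPlane m) hσ hσ ℓ f θ hE1
  refine ⟨hf0, fun u => ?_, fun δ₀ hδ0 hδ => ?_⟩
  · rw [isWeakEigen_iff_generator hL K h hσ ℓ f θ σ u]
    exact hgeo u
  · rintro ⟨δ₁, hδ₁⟩
    exact halg δ₀ hδ0 ((isWeakEigen_iff_generator hL K h hσ ℓ f θ σ δ₀).1 hδ)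
      ⟨δ₁, (isWeakJordan_iff_generator hL K h hσ ℓ f θ σ δ₀ δ₁).1 hδ₁⟩

end SheetREvansOdd
end Summit.NavierStokesRegularity.OSWSelfSimilar

end
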